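import Literature.Probability.RandomPlanarGeometry.SAWWidePolygons
import Mathlib.Data.Nat.Log
import Mathlib.Combinatorics.Pigeonhole
import HarnessLib

/-!
# Diameter classes of self-avoiding polygons and the rotation step (DGHM20 Lemma 3.3, first half)

Topic `Literature/Probability/RandomPlanarGeometry` (continues `SAWWidePolygons.lean`: `normPolygons N` =
`SAP_N` up to translation as normal edge sets, the predicates `HasWidthGe`, `HasHeightLe`).

Source: H. Duminil-Copin, S. Ganguly, A. Hammond, I. Manolescu, *Bounding the number of
self-avoiding walks: Hammersley–Welsh with polygon insertion*, Ann. Probab. 48 (2020),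
arXiv:1809.00760, proof of Lemma 3.3 (p. 10): "Specifying the diameter `diam(p)` of a polygon
`p ∈ SAP_{2m+2}` to be `max{height(p), width(p)}`, it is easily seen that `m^{1/2} ≤ diam(p) ≤ m`.
Let `u ∈ [m^{1/2}, m]` be a number of the form `2^{-j}m` such that the set
`{p ∈ SAP_{2m+2} : u/2 ≤ diam(p) ≤ u}` has maximal cardinality among such sets. … At least half of
the polygons in the just displayed set are at least as wide as they are high; (indeed, any polygon
that does not satisfy this condition is the right-angled rotation of one that does). Writing
`\overline{WSAP}^u_{2m+2}` for the set of polygons `p ∈ SAP_{2m+2}` with `width(p) ≥ u/2` and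
`height(p) ≤ u`, we thus see that `|\overline{WSAP}^u_{2m+2}| ≥ |SAP_{2m+2}| / (2 log₂ m)`."

## Contents (namespace `Literature.Probability.RandomPlanarGeometry.SAW`), all PROVED

* `xExt E`, `yExt E` — the largest first / second coordinate of a vertex (as naturals; for NORMAL
  edge sets these are the width and the height); `hasWidthGe_of_le_xExt`, `hasHeightLe_of_yExt_le`;
  `diamExt E = max (xExt E) (yExt E)`.
* `swapSite`, `swapEdges` — the reflection in the diagonal (the source's right-angled rotation up to
  the lattice symmetries already available): a polygon goes to a polygon with the same number of
  edges, normal position is preserved, `xExt` and `yExt` are exchanged.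
* `card_le_sq_diamExt_succ` — an `N`-gon has `N ≤ (diamExt + 1)²` (it has `N` vertices in a
  `(xExt+1) × (yExt+1)` box): the source's `m^{1/2} ≤ diam(p)` up to constants.
* `exists_heavy_wideLow_class` — **dyadic pigeonhole + rotation**: for every `N` there is
  `j ≤ log₂(N+1)` with
  `|SAP_N| ≤ 2 (log₂(N+1) + 1) · |{p ∈ SAP_N : width ≥ 2^j − 1, height ≤ 2^{j+1} − 2}|`,
  and every polygon of that set has `N ≤ 4^{j+1}`.

## Design choices

* Dyadic classes are indexed by `j = log₂(diam + 1)` (`2^j ≤ diam + 1 < 2^{j+1}`), over all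
  `j ≤ log₂(N+1)`, instead of the source's `u = 2^{-j} m`; constants differ, polynomial orders agree.
* "At least as wide as high" is `yExt ≤ xExt`; the rotation is realised as the coordinate swap.
-/

noncomputable section

open Finset SimpleGraph Literature.Probability.LatticeModels Literature.Probability.Percolation
open Literature.Barriers.CriticalPhenomena.SupercriticalSAW (shiftEdges isPolygon_shiftEdges
  card_shiftEdges mem_shiftEdges_iff shiftEdges_injective)
open Literature.Probability.Percolation.SiteGadgetSystem (vertsOf mem_vertsOf)

namespace Literature.Probability.RandomPlanarGeometry.SAW

/-! ### Extents -/

/-- The largest first coordinate of a vertex of `E`, as a natural number (`0` if none; for a normal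
edge set this is `width(E)`). [cite: DuminilCopinGangulyHammondManolescu2020, §3.1 (width)] -/
def xExt (E : Finset (Sym2 (Site 2))) : ℕ := (vertsOf E).sup fun v => (v 0).toNat

/-- The largest second coordinate of a vertex of `E`, as a natural number (for a normal edge set this
is `height(E)`). [cite: DuminilCopinGangulyHammondManolescu2020, §3.1 (height)] -/
def yExt (E : Finset (Sym2 (Site 2))) : ℕ := (vertsOf E).sup fun v => (v 1).toNat

/-- The diameter `max{width, height}` of a normal edge set.
[cite: DuminilCopinGangulyHammondManolescu2020, §3.1 (proof of Lemma 3.3: diam(p))] -/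
def diamExt (E : Finset (Sym2 (Site 2))) : ℕ := max (xExt E) (yExt E)

/-- Every vertex has first coordinate at most `xExt`. [cite: DuminilCopinGangulyHammondManolescu2020, §3.1 (width)] -/
theorem toNat_apply_zero_le_xExt {E : Finset (Sym2 (Site 2))} {v : Site 2} (hv : v ∈ vertsOf E) :
    (v 0).toNat ≤ xExt E :=
  Finset.le_sup (f := fun v : Site 2 => (v 0).toNat) hv

/-- Every vertex has second coordinate at most `yExt`. [cite: DuminilCopinGangulyHammondManolescu2020, §3.1 (height)] -/
theorem toNat_apply_one_le_yExt {E : Finset (Sym2 (Site 2))} {v : Site 2} (hv : v ∈ vertsOf E) :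
    (v 1).toNat ≤ yExt E :=
  Finset.le_sup (f := fun v : Site 2 => (v 1).toNat) hv

/-- `xExt` is attained. [cite: DuminilCopinGangulyHammondManolescu2020, §3.1 (width)] -/
theorem exists_toNat_apply_zero_eq_xExt {E : Finset (Sym2 (Site 2))} (hne : (vertsOf E).Nonempty) :
    ∃ v ∈ vertsOf E, (v 0).toNat = xExt E := by
  obtain ⟨v, hv, h⟩ := Finset.exists_mem_eq_sup _ hne (fun v : Site 2 => (v 0).toNat)
  exact ⟨v, hv, h.symm⟩

/-- `yExt` is attained. [cite: DuminilCopinGangulyHammondManolescu2020, §3.1 (height)] -/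
theorem exists_toNat_apply_one_eq_yExt {E : Finset (Sym2 (Site 2))} (hne : (vertsOf E).Nonempty) :
    ∃ v ∈ vertsOf E, (v 1).toNat = yExt E := by
  obtain ⟨v, hv, h⟩ := Finset.exists_mem_eq_sup _ hne (fun v : Site 2 => (v 1).toNat)
  exact ⟨v, hv, h.symm⟩

/-- A normal edge set with `xExt ≥ w` has width `≥ w`. [cite: DuminilCopinGangulyHammondManolescu2020, §3.1 (width)] -/
theorem hasWidthGe_of_le_xExt {E : Finset (Sym2 (Site 2))} (hN : IsNormal E) {w : ℕ} (hw : w ≤ xExt E) :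
    HasWidthGe E w := by
  obtain ⟨hpos, ⟨a, ha, ha0⟩, -⟩ := hN
  obtain ⟨b, hb, hbx⟩ := exists_toNat_apply_zero_eq_xExt (E := E) ⟨a, ha⟩
  refine ⟨a, ha, b, hb, ?_⟩
  have hb0 : 0 ≤ b 0 := (hpos b hb).1
  have : ((b 0).toNat : ℤ) = b 0 := Int.toNat_of_nonneg hb0
  rw [ha0, zero_add, ← this]
  rw [← hbx] at hw
  exact_mod_cast hw

/-- A normal edge set with `yExt ≤ h` has height `≤ h`. [cite: DuminilCopinGangulyHammondManolescu2020, §3.1 (height)] -/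
theorem hasHeightLe_of_yExt_le {E : Finset (Sym2 (Site 2))} (hN : IsNormal E) {h : ℕ} (hh : yExt E ≤ h) :
    HasHeightLe E h := by
  intro a ha b hb
  have ha1 : 0 ≤ a 1 := (hN.1 a ha).2
  have hb1 : 0 ≤ b 1 := (hN.1 b hb).2
  have hb' : ((b 1).toNat : ℤ) = b 1 := Int.toNat_of_nonneg hb1
  have := toNat_apply_one_le_yExt hb
  have hbh : b 1 ≤ h := by rw [← hb']; exact_mod_cast this.trans hh
  linarith

/-! ### The coordinate swap (rotation step) -/

/-- The reflection of `ℤ²` in the diagonal: `(a, b) ↦ (b, a)`. [cite: DuminilCopinGangulyHammondManolescu2020, §3.1 (proof of Lemma 3.3: "the right-angled rotation")] -/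
def swapSite (v : Site 2) : Site 2 := siteXY (v 1) (v 0)

/-- First coordinate of the swap. [cite: DuminilCopinGangulyHammondManolescu2020, §3.1 (proof of Lemma 3.3: "the right-angled rotation")] -/
@[simp] theorem swapSite_zero (v : Site 2) : swapSite v 0 = v 1 := rfl

/-- Second coordinate of the swap. [cite: DuminilCopinGangulyHammondManolescu2020, §3.1 (proof of Lemma 3.3: "the right-angled rotation")] -/
@[simp] theorem swapSite_one (v : Site 2) : swapSite v 1 = v 0 := rfl

/-- The swap is an involution. [cite: DuminilCopinGangulyHammondManolescu2020, §3.1 (proof of Lemma 3.3)] -/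
@[simp] theorem swapSite_swapSite (v : Site 2) : swapSite (swapSite v) = v := by
  funext i; fin_cases i <;> rfl

/-- The swap is injective. [cite: DuminilCopinGangulyHammondManolescu2020, §3.1 (proof of Lemma 3.3)] -/
theorem swapSite_injective : Function.Injective swapSite := fun v w h => by
  rw [← swapSite_swapSite v, h, swapSite_swapSite]

/-- The swap preserves adjacency in `ℤ²`. [cite: DuminilCopinGangulyHammondManolescu2020, §3.1 (proof of Lemma 3.3)] -/
theorem zdGraph_adj_swapSite {v w : Site 2} (h : (zdGraph 2).Adj v w) :
    (zdGraph 2).Adj (swapSite v) (swapSite w) := by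
  rw [zdGraph_adj_iff] at h ⊢
  obtain ⟨i, hi | hi⟩ := h
  · refine ⟨1 - i, Or.inl ?_⟩
    funext k; fin_cases i <;> fin_cases k <;> simp [hi, swapSite, siteXY]
  · refine ⟨1 - i, Or.inr ?_⟩
    funext k; fin_cases i <;> fin_cases k <;> simp [hi, swapSite, siteXY]

/-- The swap as a graph homomorphism. [cite: DuminilCopinGangulyHammondManolescu2020, §3.1 (proof of Lemma 3.3)] -/
def swapHom : zdGraph 2 →g zdGraph 2 where
  toFun := swapSite
  map_rel' h := zdGraph_adj_swapSite h

/-- The image of an edge set under the swap. [cite: DuminilCopinGangulyHammondManolescu2020, §3.1 (proof of Lemma 3.3)] -/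
def swapEdges (E : Finset (Sym2 (Site 2))) : Finset (Sym2 (Site 2)) := E.image (Sym2.map swapSite)

/-- Vertices of the swapped edge set. [cite: DuminilCopinGangulyHammondManolescu2020, §3.1 (proof of Lemma 3.3)] -/
theorem mem_vertsOf_swapEdges {E : Finset (Sym2 (Site 2))} {v : Site 2} :
    v ∈ vertsOf (swapEdges E) ↔ swapSite v ∈ vertsOf E := by
  simp only [mem_vertsOf, swapEdges, Finset.mem_image]
  constructor
  · rintro ⟨e, ⟨e', he', rfl⟩, hv⟩
    refine ⟨e', he', ?_⟩
    induction e' using Sym2.ind with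
    | _ a b =>
      simp only [Sym2.map_mk, Sym2.mem_iff] at hv ⊢
      rcases hv with rfl | rfl <;> simp
  · rintro ⟨e', he', hv⟩
    refine ⟨Sym2.map swapSite e', ⟨e', he', rfl⟩, ?_⟩
    induction e' using Sym2.ind with
    | _ a b =>
      simp only [Sym2.map_mk, Sym2.mem_iff] at hv ⊢
      rcases hv with h | h
      · exact Or.inl (by rw [← h, swapSite_swapSite])
      · exact Or.inr (by rw [← h, swapSite_swapSite])

/-- Swapping twice is the identity. [cite: DuminilCopinGangulyHammondManolescu2020, §3.1 (proof of Lemma 3.3)] -/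
theorem swapEdges_swapEdges (E : Finset (Sym2 (Site 2))) : swapEdges (swapEdges E) = E := by
  rw [swapEdges, swapEdges, Finset.image_image]
  have : Sym2.map swapSite ∘ Sym2.map swapSite = id := by
    funext e; simp [Sym2.map_map]
  rw [this, Finset.image_id]

/-- The swap is injective on edge sets. [cite: DuminilCopinGangulyHammondManolescu2020, §3.1 (proof of Lemma 3.3)] -/
theorem swapEdges_injective : Function.Injective swapEdges := fun E F h => by
  rw [← swapEdges_swapEdges E, h, swapEdges_swapEdges]

/-- The swap preserves the number of edges. [cite: DuminilCopinGangulyHammondManolescu2020, §3.1 (proof of Lemma 3.3)] -/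
theorem card_swapEdges (E : Finset (Sym2 (Site 2))) : (swapEdges E).card = E.card :=
  Finset.card_image_of_injective _ (Sym2.map.injective swapSite_injective)

/-- A swapped polygon is a polygon. [cite: DuminilCopinGangulyHammondManolescu2020, §3.1 (proof of Lemma 3.3)] -/
theorem isPolygon_swapEdges {E : Finset (Sym2 (Site 2))} (hE : IsPolygon (zdGraph 2) E) :
    IsPolygon (zdGraph 2) (swapEdges E) := by
  classical
  obtain ⟨u, w, hw, rfl⟩ := hE
  refine ⟨_, w.map swapHom, hw.map swapSite_injective, ?_⟩
  rw [Walk.edges_map]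
  ext e
  simp only [List.mem_toFinset, List.mem_map, swapEdges, Finset.mem_image]
  rfl

/-- Normal position is swap invariant. [cite: DuminilCopinGangulyHammondManolescu2020, §3.1 (proof of Lemma 3.3)] -/
theorem isNormal_swapEdges {E : Finset (Sym2 (Site 2))} (hN : IsNormal E) : IsNormal (swapEdges E) := by
  obtain ⟨hpos, ⟨a, ha, ha0⟩, ⟨b, hb, hb0⟩⟩ := hN
  refine ⟨fun v hv => ?_, ⟨swapSite b, ?_, by simp [hb0]⟩, ⟨swapSite a, ?_, by simp [ha0]⟩⟩
  · have := hpos _ (mem_vertsOf_swapEdges.1 hv)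
    simp only [swapSite_zero, swapSite_one] at this
    exact ⟨this.2, this.1⟩
  · exact mem_vertsOf_swapEdges.2 (by rw [swapSite_swapSite]; exact hb)
  · exact mem_vertsOf_swapEdges.2 (by rw [swapSite_swapSite]; exact ha)

/-- The swap exchanges the extents. [cite: DuminilCopinGangulyHammondManolescu2020, §3.1 (proof of Lemma 3.3)] -/
theorem xExt_swapEdges (E : Finset (Sym2 (Site 2))) : xExt (swapEdges E) = yExt E := by
  apply le_antisymm
  · refine Finset.sup_le fun v hv => ?_
    have := toNat_apply_one_le_yExt (mem_vertsOf_swapEdges.1 hv)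
    simpa using this
  · refine Finset.sup_le fun v hv => ?_
    have hv' : swapSite v ∈ vertsOf (swapEdges E) :=
      mem_vertsOf_swapEdges.2 (by rw [swapSite_swapSite]; exact hv)
    have := toNat_apply_zero_le_xExt hv'
    simpa using this

/-- The swap exchanges the extents. [cite: DuminilCopinGangulyHammondManolescu2020, §3.1 (proof of Lemma 3.3)] -/
theorem yExt_swapEdges (E : Finset (Sym2 (Site 2))) : yExt (swapEdges E) = xExt E := by
  have := xExt_swapEdges (swapEdges E)
  rw [swapEdges_swapEdges] at this
  exact this.symm

/-- The diameter is swap invariant. [cite: DuminilCopinGangulyHammondManolescu2020, §3.1 (proof of Lemma 3.3)] -/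
theorem diamExt_swapEdges (E : Finset (Sym2 (Site 2))) : diamExt (swapEdges E) = diamExt E := by
  rw [diamExt, diamExt, xExt_swapEdges, yExt_swapEdges, max_comm]

/-- The swap preserves `SAP_N`. [cite: DuminilCopinGangulyHammondManolescu2020, §3.1 (proof of Lemma 3.3)] -/
theorem swapEdges_mem_normPolygons {N : ℕ} {E : Finset (Sym2 (Site 2))} (hE : E ∈ normPolygons N) :
    swapEdges E ∈ normPolygons N := by
  obtain ⟨hP, hc, hN⟩ := mem_normPolygons.1 hE
  exact mem_normPolygons.2 ⟨isPolygon_swapEdges hP, by rw [card_swapEdges, hc], isNormal_swapEdges hN⟩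

/-! ### `N ≤ (diam + 1)²` -/

/-- A normal `N`-gon has `N ≤ (xExt + 1)(yExt + 1)`: its `N` vertices lie in that box.
[cite: DuminilCopinGangulyHammondManolescu2020, §3.1 (proof of Lemma 3.3: "m^{1/2} ≤ diam(p)")] -/
theorem card_le_xExt_succ_mul_yExt_succ {N : ℕ} {E : Finset (Sym2 (Site 2))} (hE : E ∈ normPolygons N) :
    N ≤ (xExt E + 1) * (yExt E + 1) := by
  classical
  obtain ⟨hP, hc, hN⟩ := mem_normPolygons.1 hE
  obtain ⟨u, c, hcyc, rfl⟩ := hP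
  -- `N` distinct vertices
  have hverts : c.support.tail.toFinset ⊆ vertsOf c.edges.toFinset := by
    intro v hv
    exact (mem_vertsOf_iff_mem_support hcyc).2 (List.mem_of_mem_tail (List.mem_toFinset.1 hv))
  have hcardV : c.support.tail.toFinset.card = c.edges.toFinset.card := by
    rw [List.toFinset_card_of_nodup hcyc.support_nodup, List.toFinset_card_of_nodup hcyc.edges_nodup,
      Walk.length_edges, List.length_tail, Walk.length_support]
    rfl
  -- inside the box
  have hbox : vertsOf c.edges.toFinset ⊆
      (Finset.range (xExt c.edges.toFinset + 1) ×ˢ Finset.range (yExt c.edges.toFinset + 1)).image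
        fun ab => siteXY ab.1 ab.2 := by
    intro v hv
    have h0 := (hN.1 v hv).1
    have h1 := (hN.1 v hv).2
    have hx := toNat_apply_zero_le_xExt hv
    have hy := toNat_apply_one_le_yExt hv
    rw [Finset.mem_image]
    refine ⟨((v 0).toNat, (v 1).toNat), Finset.mem_product.2 ⟨Finset.mem_range.2 (by omega),
      Finset.mem_range.2 (by omega)⟩, ?_⟩
    funext i; fin_cases i
    · show ((v 0).toNat : ℤ) = v 0; exact Int.toNat_of_nonneg h0
    · show ((v 1).toNat : ℤ) = v 1; exact Int.toNat_of_nonneg h1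
  calc N = c.edges.toFinset.card := hc.symm
    _ = c.support.tail.toFinset.card := hcardV.symm
    _ ≤ (vertsOf c.edges.toFinset).card := Finset.card_le_card hverts
    _ ≤ _ := Finset.card_le_card hbox
    _ ≤ (Finset.range (xExt c.edges.toFinset + 1) ×ˢ Finset.range (yExt c.edges.toFinset + 1)).card :=
        Finset.card_image_le
    _ = (xExt c.edges.toFinset + 1) * (yExt c.edges.toFinset + 1) := by
        rw [Finset.card_product, Finset.card_range, Finset.card_range]

/-- A normal `N`-gon has `N ≤ (diamExt + 1)²`. [cite: DuminilCopinGangulyHammondManolescu2020, §3.1 (proof of Lemma 3.3: "m^{1/2} ≤ diam(p)")] -/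
theorem card_le_sq_diamExt_succ {N : ℕ} {E : Finset (Sym2 (Site 2))} (hE : E ∈ normPolygons N) :
    N ≤ (diamExt E + 1) ^ 2 := by
  have h := card_le_xExt_succ_mul_yExt_succ hE
  have hx : xExt E ≤ diamExt E := le_max_left _ _
  have hy : yExt E ≤ diamExt E := le_max_right _ _
  calc N ≤ (xExt E + 1) * (yExt E + 1) := h
    _ ≤ (diamExt E + 1) * (diamExt E + 1) := Nat.mul_le_mul (by omega) (by omega)
    _ = (diamExt E + 1) ^ 2 := (sq _).symm

/-- The extents of a normal `N`-gon are at most `N`. [cite: DuminilCopinGangulyHammondManolescu2020, §3.1 (proof of Lemma 3.3: "diam(p) ≤ m")] -/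
theorem diamExt_le_card {N : ℕ} {E : Finset (Sym2 (Site 2))} (hE : E ∈ normPolygons N) : diamExt E ≤ N := by
  obtain ⟨hP, hc, hN⟩ := mem_normPolygons.1 hE
  refine max_le (Finset.sup_le fun v hv => ?_) (Finset.sup_le fun v hv => ?_)
  · have := (coord_mem_Icc_of_isNormal hP hN hv 0).2
    rw [hc] at this; omega
  · have := (coord_mem_Icc_of_isNormal hP hN hv 1).2
    rw [hc] at this; omega

/-! ### Dyadic pigeonhole and rotation -/

/-- The dyadic diameter class `j = log₂(diam + 1)`. [cite: DuminilCopinGangulyHammondManolescu2020, §3.1 (proof of Lemma 3.3: "u of the form 2^{-j}m")] -/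
def diamClass (E : Finset (Sym2 (Site 2))) : ℕ := Nat.log 2 (diamExt E + 1)

/-- **Dyadic pigeonhole with the rotation step.** For every `N` there is a dyadic class
`j ≤ log₂(N+1)` such that the normal `N`-gons of width `≥ 2^j − 1` and height `≤ 2^{j+1} − 2`
carry a `1/(2(log₂(N+1)+1))` fraction of `SAP_N`:
`|SAP_N| ≤ 2 (log₂(N+1) + 1) · |{p ∈ SAP_N : width ≥ 2^j − 1, height ≤ 2^{j+1} − 2}| + 2(log₂(N+1)+1)`
(the additive term absorbs integer division), and every member `p` of that set has
`2^j ≤ diamExt p + 1 < 2^{j+1}`. [cite: DuminilCopinGangulyHammondManolescu2020, Lemma 3.3 (proof: "|WSAP-bar^u_{2m+2}| ≥ |SAP_{2m+2}| / (2 log₂ m)")] -/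
theorem exists_heavy_wideLow_class (N : ℕ) :
    ∃ j ≤ Nat.log 2 (N + 1),
      (normPolygons N).card ≤ 2 * (Nat.log 2 (N + 1) + 1) *
        ((normPolygons N).filter fun E => diamClass E = j ∧ yExt E ≤ xExt E).card + 2 * (Nat.log 2 (N + 1) + 1) ∧
      ∀ E ∈ (normPolygons N).filter (fun E => diamClass E = j ∧ yExt E ≤ xExt E),
        HasWidthGe E (2 ^ j - 1) ∧ HasHeightLe E (2 ^ (j + 1) - 2) ∧ 2 ^ j ≤ diamExt E + 1 ∧
          diamExt E + 1 < 2 ^ (j + 1) := by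
  classical
  set S := normPolygons N with hSdef
  set L := Nat.log 2 (N + 1) with hL
  -- classes take values in `range (L+1)`
  have hcl : ∀ E ∈ S, diamClass E ∈ Finset.range (L + 1) := by
    intro E hE
    rw [Finset.mem_range, Nat.lt_succ_iff, diamClass, hL]
    exact Nat.log_mono_right (by have := diamExt_le_card hE; omega)
  -- pigeonhole: a class with `≥ |S| / (L+1)` members
  obtain ⟨j, hj, hjcard⟩ := Finset.exists_le_card_fiber_of_mul_le_card_of_maps_to hcl
    ⟨0, Finset.mem_range.2 (by omega)⟩ (n := S.card / (L + 1)) (by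
      rw [Finset.card_range]; exact Nat.mul_div_le S.card (L + 1))
  refine ⟨j, by rw [Finset.mem_range] at hj; omega, ?_, ?_⟩
  · -- rotation: the class `C_j` splits into `A = {yExt ≤ xExt}` and its swap image
    set Cj := S.filter (fun E => diamClass E = j) with hCj
    set A := S.filter (fun E => diamClass E = j ∧ yExt E ≤ xExt E) with hA
    have hsplit : Cj.card ≤ 2 * A.card := by
      -- `Cj ⊆ A ∪ swap(A)`-type count: `Cj \ A` injects into `A` by the swap
      have hB : (Cj.filter fun E => ¬ (yExt E ≤ xExt E)).card ≤ A.card := by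
        refine Finset.card_le_card_of_injOn swapEdges (fun E hE => ?_) (fun E _ F _ h => swapEdges_injective h)
        obtain ⟨hE, hyx⟩ := Finset.mem_filter.1 hE
        obtain ⟨hES, hEj⟩ := Finset.mem_filter.1 hE
        refine Finset.mem_filter.2 ⟨swapEdges_mem_normPolygons hES, ?_, ?_⟩
        · rw [diamClass, diamExt_swapEdges]; exact hEj
        · rw [xExt_swapEdges, yExt_swapEdges]; omega
      have hAB : Cj.card ≤ A.card + (Cj.filter fun E => ¬ (yExt E ≤ xExt E)).card := by
        have : A = Cj.filter (fun E => yExt E ≤ xExt E) := by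
          rw [hA, hCj, Finset.filter_filter]
        rw [this]
        exact (Finset.card_filter_add_card_filter_not _).symm.le
      omega
    have h1 : S.card / (L + 1) ≤ Cj.card := hjcard
    have h2 : S.card ≤ (L + 1) * (S.card / (L + 1)) + (L + 1) := by
      have := Nat.div_add_mod S.card (L + 1)
      have := Nat.mod_lt S.card (show 0 < L + 1 by omega)
      omega
    calc S.card ≤ (L + 1) * (S.card / (L + 1)) + (L + 1) := h2
      _ ≤ (L + 1) * (2 * A.card) + (L + 1) := by gcongr; exact h1.trans hsplit
      _ ≤ 2 * (L + 1) * A.card + 2 * (L + 1) := by ring_nf; omega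
  · intro E hE
    obtain ⟨hES, hEj, hyx⟩ := Finset.mem_filter.1 hE
    obtain ⟨hP, hc, hN⟩ := mem_normPolygons.1 hES
    have hlow : 2 ^ j ≤ diamExt E + 1 := by rw [← hEj, diamClass]; exact Nat.pow_log_le_self 2 (by omega)
    have hup : diamExt E + 1 < 2 ^ (j + 1) := by rw [← hEj, diamClass]; exact Nat.lt_pow_succ_log_self (by norm_num) _
    have hx : diamExt E = xExt E := max_eq_left hyx
    refine ⟨hasWidthGe_of_le_xExt hN (by omega), hasHeightLe_of_yExt_le hN (by omega), hlow, hup⟩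

end Literature.Probability.RandomPlanarGeometry.SAW
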